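import Summits.BirchSwinnertonDyer.BirchSwinnertonDyer.Theorems.AlignedTransportAtTwoMainConjectureOfRankZeroBSDAtTwoSexticLambdaKuroda
import Summits.BirchSwinnertonDyer.BirchSwinnertonDyer.Theorems.AlignedTransportAtTwoMainConjectureOfRankZeroBSDAtTwoResolventLambdaParitySeeds
import HarnessLib

/-!
# Route `AlignedTransportAtTwo`, crux C2 `MainConjectureOfRankZeroBSDAtTwo` (stmt-BirchSwinnertonDyer-22298):
# SEED ROWS of the `S₃` Kuroda relation — `λ₂(ℚ(W[2])) = 17 + 2λ₂(ℚ(β))` (7831a1), `= 33 + 2λ₂(ℚ(β))` (24213c1), `= 3 + 2λ₂(ℚ(β))` (25861b1)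

HONEST FRAMING (cell `bsd-f1-sign2`, WIDTH-5 attached prover seat `bsd-line-att-p3` gen 33, line `birth`, lead `bsd-line-att-p2`; `--supports`
stmt-BirchSwinnertonDyer-22298, closes nothing; BSD is NOT proved; crux C2 untouched).  THEOREMS ONLY.  g29's seed rows
(`…ResolventLambdaParitySeeds`: `λ₂(T) ≥ 17 / 33 / 3`, conditional on the then-named fact Ferrero–Kida and on `μ₂(T) = 0`) become EXACT rows,
conditional only on `μ₂ = 0` (growth form) for the cyclotomic `ℤ₂`-towers of the three cubic fields `ℚ(β_i)` of the seed (Ferrero–Kida is g32's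
theorem; the relation is this seat's `classicalLambda_divisionField_two_add_one_eq`):

| seed | `Δ_min` | `d` | `Σ(d)` | row |
|---|---|---|---|---|
| 7831a1 | `−7831·41²` | `41·191` | `18` | `λ₂(T) + 1 = 2λ₂(ℚ(β)) + 18` |
| 24213c1 | `−8071·(3¹⁰·7³·1153)²` | `7·1153` | `34` | `λ₂(T) + 1 = 2λ₂(ℚ(β)) + 34` |
| 25861b1 | `−2351·(11⁴)²` | `2351` | `4` | `λ₂(T) + 1 = 2λ₂(ℚ(β)) + 4` |

So a `2`-rank certificate of value `17` (resp. `33`, `3`) on the sextic tower would force `λ₂(ℚ(β)) = 0` for the cubic field of the seed, and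
conversely every unit of cubic `λ₂` costs two units of sextic `λ₂` (-data steer: certify on the CUBIC tower, degree `3·2ⁿ`).

References: [Schettler2014] Thm. 2; [CremonaAlgorithms1997] Table 1; tree `…SexticLambdaKuroda` (this seat), `…ResolventLambdaParitySeeds` (g29),
`ByReductionTypeAtTwoTowerClass{7831a,24213c,25861b}` (the seed models).
-/

set_option linter.dupNamespace false
set_option autoImplicit false

noncomputable section

open scoped Classical NumberField

namespace Summit.BirchSwinnertonDyer.BirchSwinnertonDyer.Theorems.AlignedTransportAtTwoSexticLambdaKuroda

open Polynomial WeierstrassCurve IntermediateField Field NumberField Finset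
  Literature.NumberTheory.EllipticCurves Literature.NumberTheory.EllipticCurves.Greenberg1999 Literature.NumberTheory.GaloisRepresentations
  Literature.NumberTheory.EllipticCurves.DokchitserDokchitser2012 Literature.NumberTheory.EllipticCurves.ZpExtension
  Literature.NumberTheory.IwasawaTheory Literature.NumberTheory.NumberFields
  Summit.BirchSwinnertonDyer.Rank1Residual.F1Sign2
  Summit.BirchSwinnertonDyer.BirchSwinnertonDyer.Theorems.AlignedTransportAtTwoResolventLambdaParitySeeds
  Summit.BirchSwinnertonDyer.BirchSwinnertonDyer.Theorems.AlignedTransportAtTwoFineRoad.DivisionCubic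
  Summit.BirchSwinnertonDyer.BirchSwinnertonDyer.Theorems.TowerClass

/-- ★ **7831a1: `λ₂(ℚ(W[2])) + 1 = 2·λ₂(ℚ(β_j)) + 18`**, i.e. `λ₂(T) = 17 + 2λ₂(ℚ(β))`, for any cyclotomic normalisations, granted `μ₂ = 0` on the
three cubic towers (`Δ_min = −7831·41²`, `7831 = 41·191`, `Σ = 2 + 16`). Conditional; BSD is not proved by any of this.
[cite: Schettler2014, Thm. 2] [cite: CremonaAlgorithms1997, Table 1] -/
theorem classicalLambda_7831a1_add_one_eq
    (hμ3 : ∀ i : Fin 3, ∀ κi : ZpExtension ↥ℚ⟮xT c7831a1 two_ne_zero i⟯ 2, κi.IsCyclotomic → ClassicalMuVanishes κi)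
    (j : Fin 3) (κT : ZpExtension (c7831a1.divisionField 2) 2) (hκT : κT.IsCyclotomic)
    (κk : ZpExtension ↥ℚ⟮xT c7831a1 two_ne_zero j⟯ 2) (hκk : κk.IsCyclotomic) :
    classicalLambda κT + 1 = 2 * classicalLambda κk + 18 := by
  have hΔ : c7831a1.Δ = -((7831 : ℕ) : ℚ) * (41 : ℚ) ^ 2 := by rw [baseChange_int_Δ, M7831a1_Δ]; norm_num
  have hd : Squarefree (7831 : ℕ) := by
    rw [show (7831 : ℕ) = 41 * 191 by norm_num]
    exact (Nat.squarefree_mul (by norm_num)).mpr ⟨(Nat.prime_iff.mp (by norm_num)).squarefree, (Nat.prime_iff.mp (by norm_num)).squarefree⟩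
  have h := classicalLambda_divisionField_two_add_one_eq c7831a1 not_hasRationalTwoTorsionX_7831a1 hd (by norm_num)
    (by norm_num : (41 : ℚ) ≠ 0) hΔ hμ3 j κT hκT κk hκk
  rw [ferreroKidaSum_7831] at h
  exact h

/-- ★ **24213c1: `λ₂(ℚ(W[2])) + 1 = 2·λ₂(ℚ(β_j)) + 34`**, i.e. `λ₂(T) = 33 + 2λ₂(ℚ(β))` (`Δ_min = −8071·(23352639471)²`, `8071 = 7·1153`,
`Σ = 2 + 32`), granted `μ₂ = 0` on the three cubic towers. Conditional; BSD is not proved by any of this.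
[cite: Schettler2014, Thm. 2] [cite: CremonaAlgorithms1997, Table 1] -/
theorem classicalLambda_24213c1_add_one_eq
    (hμ3 : ∀ i : Fin 3, ∀ κi : ZpExtension ↥ℚ⟮xT c24213c1 two_ne_zero i⟯ 2, κi.IsCyclotomic → ClassicalMuVanishes κi)
    (j : Fin 3) (κT : ZpExtension (c24213c1.divisionField 2) 2) (hκT : κT.IsCyclotomic)
    (κk : ZpExtension ↥ℚ⟮xT c24213c1 two_ne_zero j⟯ 2) (hκk : κk.IsCyclotomic) :
    classicalLambda κT + 1 = 2 * classicalLambda κk + 34 := by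
  have hΔ : c24213c1.Δ = -((8071 : ℕ) : ℚ) * (23352639471 : ℚ) ^ 2 := by rw [baseChange_int_Δ, M24213c1_Δ]; norm_num
  have hd : Squarefree (8071 : ℕ) := by
    rw [show (8071 : ℕ) = 7 * 1153 by norm_num]
    exact (Nat.squarefree_mul (by norm_num)).mpr ⟨(Nat.prime_iff.mp (by norm_num)).squarefree, (Nat.prime_iff.mp (by norm_num)).squarefree⟩
  have h := classicalLambda_divisionField_two_add_one_eq c24213c1 not_hasRationalTwoTorsionX_24213c1 hd (by norm_num)
    (by norm_num : (23352639471 : ℚ) ≠ 0) hΔ hμ3 j κT hκT κk hκk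
  rw [ferreroKidaSum_8071] at h
  exact h

/-- ★ **25861b1: `λ₂(ℚ(W[2])) + 1 = 2·λ₂(ℚ(β_j)) + 4`**, i.e. `λ₂(T) = 3 + 2λ₂(ℚ(β))` (`Δ_min = −2351·(11⁴)²`, `2351` prime, `Σ = 4`), granted
`μ₂ = 0` on the three cubic towers; a `2`-rank certificate of value `3` on the sextic (g26/g28) would force `λ₂(ℚ(β)) = 0`. Conditional; BSD is not
proved by any of this. [cite: Schettler2014, Thm. 2] [cite: CremonaAlgorithms1997, Table 1] -/
theorem classicalLambda_25861b1_add_one_eq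
    (hμ3 : ∀ i : Fin 3, ∀ κi : ZpExtension ↥ℚ⟮xT c25861b1 two_ne_zero i⟯ 2, κi.IsCyclotomic → ClassicalMuVanishes κi)
    (j : Fin 3) (κT : ZpExtension (c25861b1.divisionField 2) 2) (hκT : κT.IsCyclotomic)
    (κk : ZpExtension ↥ℚ⟮xT c25861b1 two_ne_zero j⟯ 2) (hκk : κk.IsCyclotomic) :
    classicalLambda κT + 1 = 2 * classicalLambda κk + 4 := by
  have hΔ : c25861b1.Δ = -((2351 : ℕ) : ℚ) * (14641 : ℚ) ^ 2 := by rw [baseChange_int_Δ, M25861b1_Δ]; norm_num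
  have hd : Squarefree (2351 : ℕ) := (Nat.prime_iff.mp (by norm_num)).squarefree
  have h := classicalLambda_divisionField_two_add_one_eq c25861b1 not_hasRationalTwoTorsionX_25861b1 hd (by norm_num)
    (by norm_num : (14641 : ℚ) ≠ 0) hΔ hμ3 j κT hκT κk hκk
  rw [ferreroKidaSum_2351] at h
  exact h

end Summit.BirchSwinnertonDyer.BirchSwinnertonDyer.Theorems.AlignedTransportAtTwoSexticLambdaKuroda

end
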